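import Summits.Ventures.CertifiedArithmetic.LowPrec.GemmThetaE2M1Data

/-!
# The θ-certificate of E2M1²→bfloat16 sequential accumulation: kernel check, upper binades

HONEST FRAMING (venture CertifiedArithmetic / cell `pub-lowprec`, seat gemm, gen 6): certified error
envelopes and provably optimal rounding/accumulation schemes for low-precision formats under stated
cost models; every table by two implementations; no hardware or vendor claims.

Second half of the kernel check of `GemmThetaE2M1Data.lean` (states with index `640 ≤ i ≤ 1280`,
i.e. magnitudes `2^12 ≤ 4v ≤ 2^16` in quarter units): every edge passes `edgeOK`.  Split off only to
keep each file's kernel time near two minutes.  See that file for the meaning of the check and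
`GemmThetaE2M1.lean` for the theorem it feeds (paper `gemm.tex` §Regimes Prop. Θ(i)).
-/

namespace Literature.ComputerArithmetic.FloatingPoint

namespace MiniFloat

namespace ThetaE2M1

/-- Every edge from the states with index in `[640, 768)` (both signs, all 37 letters) passes
`edgeOK`. [cell certificate, kernel-checked] -/
theorem edges_ok_640 :
    ((List.range' 640 128).all fun i => lamQ.all fun Q => edgeOK false i Q && edgeOK true i Q) = true := by
  decide +kernel

/-- Every edge from the states with index in `[768, 896)` (both signs, all 37 letters) passes
`edgeOK`. [cell certificate, kernel-checked] -/
theorem edges_ok_768 :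
    ((List.range' 768 128).all fun i => lamQ.all fun Q => edgeOK false i Q && edgeOK true i Q) = true := by
  decide +kernel

/-- Every edge from the states with index in `[896, 1024)` (both signs, all 37 letters) passes
`edgeOK`. [cell certificate, kernel-checked] -/
theorem edges_ok_896 :
    ((List.range' 896 128).all fun i => lamQ.all fun Q => edgeOK false i Q && edgeOK true i Q) = true := by
  decide +kernel

/-- Every edge from the states with index in `[1024, 1152)` (both signs, all 37 letters) passes
`edgeOK`. [cell certificate, kernel-checked] -/
theorem edges_ok_1024 :
    ((List.range' 1024 128).all fun i => lamQ.all fun Q => edgeOK false i Q && edgeOK true i Q) = true := by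
  decide +kernel

/-- Every edge from the states with index in `[1152, 1280)` (both signs, all 37 letters) passes
`edgeOK`. [cell certificate, kernel-checked] -/
theorem edges_ok_1152 :
    ((List.range' 1152 128).all fun i => lamQ.all fun Q => edgeOK false i Q && edgeOK true i Q) = true := by
  decide +kernel

/-- Every edge from the states with index in `[1280, 1281)` (both signs, all 37 letters) passes
`edgeOK`. [cell certificate, kernel-checked] -/
theorem edges_ok_1280 :
    ((List.range' 1280 1).all fun i => lamQ.all fun Q => edgeOK false i Q && edgeOK true i Q) = true := by
  decide +kernel

end ThetaE2M1

end MiniFloat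

end Literature.ComputerArithmetic.FloatingPoint
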